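import Summits.ResolutionOfSingularities.ResolutionOfSingularities.Theorems.FrobeniusLadderFRationalResolutionIsolatedConeHypotheses
import Mathlib.Algebra.Module.Equiv.Basic
import HarnessLib

/-!
# Crux `FrobeniusLadder.FRationalResolution` (stmt-ResolutionOfSingularities-15317), line `redirect`,
# stub `stub_diagonalizableQuotientResolution` — the group `G` of the ladder from WEIGHT PERMUTATIONS (lane W‴, brick T2)

In lane W‴ the symmetry of the twisted chart is a finite group `Perms` of permutations `π` of the coordinates acting on the dual
space by `v ↦ v ∘ π` (`…SafeRayCentreStable.map_span_centre_le_span_centre`, ✓ p830301: `hrays`, `hf`), preserving the dual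
lattice `N`. After the coordinate change `φ` (`v ∈ N ↔ φ v ∈ ℤⁿ`, ✓ p831688) the ladder theorems want a finite set `G` of
lattice automorphisms of `ℤⁿ` containing `1`, closed under inverses and composition, permuting `S₀ = φ(e_•)`. This file builds
`G = {φ ∘ P_π ∘ φ⁻¹ : π ∈ Perms}` with `P_π = LinearEquiv.funCongrLeft ℚ ℚ π` (`(P_π v) l = v (π l)`) and checks those hypotheses.

* `funCongrLeft_single` — `P_π e_l = e_{π⁻¹ l}`;
* `conj_refl`, `conj_symm`, `conj_trans` — `π ↦ φ P_π φ⁻¹` is a homomorphism (up to the order conventions of `trans`);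
* `conj_mem_latticeN` — lattice preservation from `P_π N ⊆ N`; `conj_map_single_mem` — `G` permutes `S₀`;
* **`conjSet_hypotheses`** — the five `G`-hypotheses of `…SafeLadder.exists_equivariant_projective_ladder_safe` for `G = image of Perms`.

Honest label: bookkeeping for the DESIGN W‴ (brick T2). No stub closed by name. No definitions, no named facts, no sorry. [folklore]
-/

-- single-problem summit: the doubled namespace component is forced
set_option linter.dupNamespace false

namespace Summit.ResolutionOfSingularities.ResolutionOfSingularities.Theorems.FRationalResolution.PermutationAction

open Literature.Geometry.PolyhedralFans

variable {n : ℕ}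

/-- `P_π e_l = e_{π⁻¹ l}` for the coordinate action `(P_π v) l = v (π l)`. [folklore] -/
theorem funCongrLeft_single (π : Equiv.Perm (Fin n)) (l : Fin n) :
    LinearEquiv.funCongrLeft ℚ ℚ π (Pi.single l (1 : ℚ) : Fin n → ℚ) = Pi.single (π.symm l) 1 := by
  ext i
  rw [LinearEquiv.funCongrLeft_apply, LinearMap.funLeft_apply]
  by_cases h : i = π.symm l
  · subst h; simp
  · have h' : π i ≠ l := fun h'' => h (by rw [← h'', Equiv.symm_apply_apply])
    simp [h, h']

/-- The conjugate of the identity permutation is the identity. [folklore] -/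
theorem conj_refl (φ : (Fin n → ℚ) ≃ₗ[ℚ] (Fin n → ℚ)) :
    φ.symm.trans ((LinearEquiv.funCongrLeft ℚ ℚ (Equiv.refl (Fin n))).trans φ) = LinearEquiv.refl ℚ (Fin n → ℚ) := by
  ext v i
  simp

/-- Inverses: `(φ P_π φ⁻¹)⁻¹ = φ P_{π⁻¹} φ⁻¹`. [folklore] -/
theorem conj_symm (φ : (Fin n → ℚ) ≃ₗ[ℚ] (Fin n → ℚ)) (π : Equiv.Perm (Fin n)) :
    (φ.symm.trans ((LinearEquiv.funCongrLeft ℚ ℚ π).trans φ)).symm =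
      φ.symm.trans ((LinearEquiv.funCongrLeft ℚ ℚ π.symm).trans φ) := by
  ext v i
  simp [LinearEquiv.funCongrLeft_apply]

/-- Composition: `(φ P_π φ⁻¹) ≫ (φ P_{π'} φ⁻¹) = φ P_{π' ≫ π} φ⁻¹`. [folklore] -/
theorem conj_trans (φ : (Fin n → ℚ) ≃ₗ[ℚ] (Fin n → ℚ)) (π π' : Equiv.Perm (Fin n)) :
    (φ.symm.trans ((LinearEquiv.funCongrLeft ℚ ℚ π).trans φ)).trans
        (φ.symm.trans ((LinearEquiv.funCongrLeft ℚ ℚ π').trans φ)) =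
      φ.symm.trans ((LinearEquiv.funCongrLeft ℚ ℚ (π'.trans π)).trans φ) := by
  ext v i
  simp [LinearEquiv.funCongrLeft_apply]

/-- **Lattice preservation**: if `v ∈ N ↔ φ v ∈ ℤⁿ` and `P_π N ⊆ N`, then `φ P_π φ⁻¹` preserves `ℤⁿ`. [folklore] -/
theorem conj_mem_latticeN (φ : (Fin n → ℚ) ≃ₗ[ℚ] (Fin n → ℚ)) {N : Set (Fin n → ℚ)}
    (hφ : ∀ v, v ∈ N ↔ φ v ∈ latticeN (Fin n)) (π : Equiv.Perm (Fin n))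
    (hπ : ∀ v ∈ N, (fun l => v (π l)) ∈ N) {x : Fin n → ℚ} (hx : x ∈ latticeN (Fin n)) :
    (φ.symm.trans ((LinearEquiv.funCongrLeft ℚ ℚ π).trans φ)) x ∈ latticeN (Fin n) := by
  have hv : φ.symm x ∈ N := (hφ _).2 (by rw [LinearEquiv.apply_symm_apply]; exact hx)
  have hmem : (fun l => φ.symm x (π l)) ∈ N := hπ _ hv
  have hfun : ((LinearEquiv.funCongrLeft ℚ ℚ π) (φ.symm x) : Fin n → ℚ) = fun l => φ.symm x (π l) := by
    ext l; rw [LinearEquiv.funCongrLeft_apply, LinearMap.funLeft_apply]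
  rw [LinearEquiv.trans_apply, LinearEquiv.trans_apply, hfun]
  exact (hφ _).1 hmem

/-- **`G` permutes `S₀ = φ(e_•)`**: `(φ P_π φ⁻¹)(φ e_l) = φ e_{π⁻¹ l}`. [folklore] -/
theorem conj_map_single_mem (φ : (Fin n → ℚ) ≃ₗ[ℚ] (Fin n → ℚ)) (π : Equiv.Perm (Fin n)) (l : Fin n) :
    (φ.symm.trans ((LinearEquiv.funCongrLeft ℚ ℚ π).trans φ)) (φ (Pi.single l (1 : ℚ))) ∈
      (Finset.univ.image fun l : Fin n => φ (Pi.single l (1 : ℚ))) := by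
  classical
  refine Finset.mem_image.mpr ⟨π.symm l, Finset.mem_univ _, ?_⟩
  rw [LinearEquiv.trans_apply, LinearEquiv.trans_apply, LinearEquiv.symm_apply_apply, funCongrLeft_single]

/-- **The `G`-hypotheses of the ladder for `G = {φ P_π φ⁻¹ : π ∈ Perms}`**: for a finite set `Perms` of permutations containing `1`,
closed under inverses and both-sided composition, acting on the dual lattice `N` (`v ∈ N ↔ φ v ∈ ℤⁿ`), the image set `G` is
finite, contains `1`, is closed under inverses and composition, preserves `ℤⁿ` and permutes `S₀ = φ(e_•)` — the inputs
`hGfin hG1 hGN hGsymm hGtrans hGS₀` of `…SafeLadder.exists_equivariant_projective_ladder_safe`. [folklore] -/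
theorem conjSet_hypotheses (φ : (Fin n → ℚ) ≃ₗ[ℚ] (Fin n → ℚ)) {N : Set (Fin n → ℚ)}
    (hφ : ∀ v, v ∈ N ↔ φ v ∈ latticeN (Fin n)) {Perms : Set (Equiv.Perm (Fin n))} (hPfin : Perms.Finite)
    (hP1 : Equiv.refl (Fin n) ∈ Perms) (hPsymm : ∀ π ∈ Perms, π.symm ∈ Perms)
    (hPtrans : ∀ π ∈ Perms, ∀ π' ∈ Perms, π.trans π' ∈ Perms)
    (hPN : ∀ π ∈ Perms, ∀ v ∈ N, (fun l => v (π l)) ∈ N) :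
    ((fun π : Equiv.Perm (Fin n) => φ.symm.trans ((LinearEquiv.funCongrLeft ℚ ℚ π).trans φ)) '' Perms).Finite ∧
    LinearEquiv.refl ℚ (Fin n → ℚ) ∈
      (fun π : Equiv.Perm (Fin n) => φ.symm.trans ((LinearEquiv.funCongrLeft ℚ ℚ π).trans φ)) '' Perms ∧
    (∀ g ∈ (fun π : Equiv.Perm (Fin n) => φ.symm.trans ((LinearEquiv.funCongrLeft ℚ ℚ π).trans φ)) '' Perms,
      ∀ x ∈ latticeN (Fin n), g x ∈ latticeN (Fin n)) ∧
    (∀ g ∈ (fun π : Equiv.Perm (Fin n) => φ.symm.trans ((LinearEquiv.funCongrLeft ℚ ℚ π).trans φ)) '' Perms,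
      g.symm ∈ (fun π : Equiv.Perm (Fin n) => φ.symm.trans ((LinearEquiv.funCongrLeft ℚ ℚ π).trans φ)) '' Perms) ∧
    (∀ g ∈ (fun π : Equiv.Perm (Fin n) => φ.symm.trans ((LinearEquiv.funCongrLeft ℚ ℚ π).trans φ)) '' Perms,
      ∀ h ∈ (fun π : Equiv.Perm (Fin n) => φ.symm.trans ((LinearEquiv.funCongrLeft ℚ ℚ π).trans φ)) '' Perms,
      g.trans h ∈ (fun π : Equiv.Perm (Fin n) => φ.symm.trans ((LinearEquiv.funCongrLeft ℚ ℚ π).trans φ)) '' Perms) ∧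
    (∀ g ∈ (fun π : Equiv.Perm (Fin n) => φ.symm.trans ((LinearEquiv.funCongrLeft ℚ ℚ π).trans φ)) '' Perms,
      ∀ s ∈ (Finset.univ.image fun l : Fin n => φ (Pi.single l (1 : ℚ))),
        g s ∈ (Finset.univ.image fun l : Fin n => φ (Pi.single l (1 : ℚ)))) := by
  classical
  refine ⟨hPfin.image _, ⟨Equiv.refl _, hP1, conj_refl φ⟩, ?_, ?_, ?_, ?_⟩
  · rintro g ⟨π, hπ, rfl⟩ x hx
    exact conj_mem_latticeN φ hφ π (hPN π hπ) hx
  · rintro g ⟨π, hπ, rfl⟩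
    exact ⟨π.symm, hPsymm π hπ, (conj_symm φ π).symm⟩
  · rintro g ⟨π, hπ, rfl⟩ h ⟨π', hπ', rfl⟩
    exact ⟨π'.trans π, hPtrans π' hπ' π hπ, (conj_trans φ π π').symm⟩
  · rintro g ⟨π, hπ, rfl⟩ s hs
    obtain ⟨l, -, rfl⟩ := Finset.mem_image.mp hs
    exact conj_map_single_mem φ π l

end Summit.ResolutionOfSingularities.ResolutionOfSingularities.Theorems.FRationalResolution.PermutationAction
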